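import Mathlib
import HarnessLib
import Summits.SmoothPoincare4.SmoothPoincare4.Theses.DiophantineRotations

/-!
# Birth skeleton (BC3) — crux `DiophantineRotations.QuasiPeriodicExistence` (stmt-SmoothPoincare4-16608)

Route `route-SmoothPoincare4-DiophantineRotations`, crux #3 (rank 3) `QuasiPeriodicExistence` (K2 of the
card fake-spheres-cannot-idle), decl
`Summit.SmoothPoincare4.SmoothPoincare4.Theses.DiophantineRotations.QuasiPeriodicExistence`:

  every smooth homotopy 4-sphere `M` (the bare carriers of `SmoothPoincare4`: Hausdorff, second countable,
  a `C^∞` atlas on `ℝ⁴`, `M ≃ₕ S⁴`) carries a diffeomorphism `F : M ≃ₘ M`, a homeomorphism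
  `h : M ≃ₜ S⁴ ⊂ ℝ⁵ = ℂ² ⊕ ℝ` and a SIMULTANEOUSLY DIOPHANTINE pair `(α, β)` with
  `h ∘ F = R_{α,β} ∘ h` pointwise, `R_{α,β}(z₁, z₂, t) = (e^{2πiα} z₁, e^{2πiβ} z₂, t)`.

Standing of the crux (item notes 2026-08-16, grounder g58 / refuter rreview): NEW / OPEN, the
SPC4-implied existence half of the route (`F = θ⁻¹ ∘ R ∘ θ`, `h = θ` under SPC4); refutable only by an
exotic `Σ`; the homeomorphism is free (Freedman fact
`Literature.Topology.FourManifolds.nonempty_homeomorph_sphere_four`), the content is the SMOOTH `F`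
preserving the transported (wild) orbit tori. `ledger crux ls stmt-SmoothPoincare4-16608`: no workfiles —
no `Disproof.lean`, no ideas, no lines, no landed `Theorems/QuasiPeriodicExistence/Negative/*`;
`ledger negatives --problem SmoothPoincare4`: 0 refuted statements (2026-08-17).

## The line: standardise near the singular strata, spin the fake free band (the route's own layer-2 plan)

The orbit structure of the linear bi-rotation `R_{α,β}` of `S⁴` (α, β, α ± β ∉ ℚ): two fixed poles
`(0, 0, ±1)`, two invariant 2-spheres `{z₂ = 0}`, `{z₁ = 0}` of circle orbits, and FREE `T²`-orbits
filling `{z₁ ≠ 0, z₂ ≠ 0} ≅ T² × (open 2-disc)`. The route file's TWO-LAYER PLAN decomposes K2 as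
"InvariantConjugacy (choose Freedman's `h` with `h`(singular 2-complex nbhd) a union of `R`-orbit
closures) → SmoothGenerator → K2". Typed here with NO new vocabulary, over Mathlib + the route file only,
with the `R`-INVARIANT model neighbourhood of the singular strata

  `N := {y ∈ S⁴ : y₀² + y₁² < 1/4 ∨ y₂² + y₃² < 1/4}`   (`|z₁| < 1/2 ∨ |z₂| < 1/2`),

whose complement `K := S⁴ ∖ N = {|z₁| ≥ 1/2 ∧ |z₂| ≥ 1/2} ≅ T² × D²` (the "free band") is a compact
`R`-invariant domain of free orbits with nonempty interior (it contains `(3/5, 0, 4/5, 0, 0)`), and with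
the arithmetically optimal frequency, the CUBIC pair `(θ, θ²)`, `θ³ = 2` (badly approximable:
Diophantine exponent `τ = 2`, the Dirichlet-optimal one for two frequencies; self-similar under the unit
group of `ℤ[θ]` — the frequencies of Koch-type renormalisation):

* `stub_cubicFrequencyDiophantine` (S1, ARITHMETIC INPUT; known in print, M-sized in Lean): for `θ³ = 2`
  the pair `(θ, θ²)` is simultaneously Diophantine with exponent `2`:
  `∃ γ > 0, ∀ (k₁, k₂) ≠ 0, ∀ m, γ ≤ |k₁θ + k₂θ² + m| · (|k₁| + |k₂|)²`. Why true: Liouville's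
  inequality in the cubic field `ℚ(θ)`: `x = m + k₁θ + k₂θ²` is a nonzero algebraic integer
  (`x³ − 2` irreducible, 2-adic descent on `m³ + 2k₁³ + 4k₂³ − 6mk₁k₂`), so
  `1 ≤ |N(x)| = |x|·|x'|·|x''|` with `|x'|, |x''| ≤ 5(|k₁| + |k₂|)` when `|x| < 1`; `γ = 1/25` works.
  Leans on: Mathlib `Real.rpow`, `Int` casts; nothing from the tree. [Cassels1957, Ch. V §3;
  Schmidt1980, Ch. II]
* `stub_invariantConjugacy` (S2, INVARIANT CONJUGACY = "standard near the singular strata"; true by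
  Freedman + the topological Schoenflies theorem + Alexander's trick, L-sized in Lean): every smooth
  homotopy 4-sphere `M` admits a homeomorphism `h : M ≃ₜ S⁴` that is `C^∞` on `h⁻¹(N)` with `C^∞`
  inverse on `N`. Why true: write `M = D ∪ C`, `D` a smooth closed 4-ball, `C = M ∖ int D` compact
  contractible with `∂C ≅ S³`; `K` contains a smooth closed round ball `B'`, and `S⁴ ∖ int B'` is a
  smooth closed 4-ball; send `D` DIFFEOMORPHICALLY onto `S⁴ ∖ int B'` (disc theorem) and `C`
  HOMEOMORPHICALLY onto `B'` extending the boundary diffeomorphism (`C ∪ D⁴ ≈ S⁴` by Freedman, `C ≈ D⁴`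
  by Brown's Schoenflies theorem, boundary matching by the Alexander trick); the glued map is a
  homeomorphism, a diffeomorphism over `S⁴ ∖ B' ⊇ N`. Leans on: the tree's named fact
  `Literature.Topology.FourManifolds.nonempty_homeomorph_sphere_four` (Freedman 1982 Thm 1.6) in the
  relative form just described; Mathlib `Homeomorph`, `ContMDiffOn`. [FreedmanJDG1982, Thm 1.6;
  Brown1960; FreedmanQuinnPMS1990, Cor. 7.1B]
* `stub_smoothGeneratorCubic` (S3, SMOOTH GENERATOR ON THE FAKE FREE BAND — THE LOAD-BEARING STUB, open):
  for `θ³ = 2` and ANY smooth 4-manifold `M` (summit binders) with a homeomorphism `h : M ≃ₜ S⁴` that is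
  `C^∞` with `C^∞` inverse over `N` (the output of S2), there are a diffeomorphism `F : M ≃ₘ M` and a
  homeomorphism `h' : M ≃ₜ S⁴` with `h' ∘ F = R_{θ,θ²} ∘ h'`. Since `N` is `R`-invariant,
  `F₀ := h⁻¹ ∘ R ∘ h` is ALREADY a local diffeomorphism on `h⁻¹(N)`; all the work is confined to the fake
  free band `W := h⁻¹(K)`, a compact smooth 4-manifold with boundary `T³`, homeomorphic rel `∂` to
  `T² × D²` and diffeomorphic to `(T² × D²) # M`: S3 ⟺ "a fake `T² × D²` (rel boundary, closing up to a
  homotopy sphere) can be spun at the cubic frequency" — the quasi-periodic Kirby problem of the route's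
  NOT DECOMPOSED YET paragraph, now Σ-local. Implied by `SmoothPoincare4` (`h' = θ_M`, `F = θ_M⁻¹ R θ_M`);
  for exotic `M` it is exactly the content of K2 at one (the best) frequency. Why it might fail: the
  smooth generator must preserve the transported orbit tori `h'⁻¹(T² × {u})`, which are wild through the
  fake band, and no construction beyond `S⁴` is known (route file, why-it-might-fail of #3); a proof of
  `DiophantineRigidity` (K1, crux #2) restricted to exotic `M` would refute it together with `¬SPC4`.
  [Freedman1982; FreedmanQuinn1990; Fintushel1978; Pao1978; Herman1979]
* `quasiPeriodicExistence_of_stubs : S1-sig → S2-sig → S3-sig → QuasiPeriodicExistence` — THE REAL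
  COMPOSITION, sorry-free, first-order logic plus the existence of the real cube root `θ = 2^{1/3}`
  (`Real.rpow_inv_natCast_pow`): given `M ≃ₕ S⁴`, S2 gives `h` standard over `N`, S3 gives `(F, h')` at
  frequency `(θ, θ²)`, S1 certifies that `(θ, θ²)` is simultaneously Diophantine (`τ = 2`), and
  `⟨F, h', θ, θ², ⟨γ, 2, …⟩, …⟩` is the crux's witness.
* `QuasiPeriodicExistence_of : QuasiPeriodicExistence` — THE SKELETON THEOREM: the crux BY NAME from the
  three declared stubs through the composition (the file's only theorem whose head is the crux).

`sorry` occurs ONLY in the three `stub_*` theorems. All three stubs are load-bearing (drop S1: no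
certified Diophantine pair; drop S2: no input for S3; drop S3: no diffeomorphism).

## Disproof used

None exists (no `Disproof.lean`, no `_false_without_` theorem, no landed Negative lemma for this crux,
2026-08-17). Honours the refuter's reading of the item (rreview 2026-08-16): the `Diffeomorph` field of the
witness needs genuine `ContMDiff` (no junk witness: `F = refl` forces `θ ∈ ℤ`, impossible as `θ³ = 2`),
and the homeomorphism part is not where the content is — S2 isolates exactly the free part (Freedman) and
S3 exactly the smooth part.

## BC3 probes

For each stub `X ∈ {S1, S2, S3}`: `X-sig → QuasiPeriodicExistence` and `X-sig → SmoothPoincare4` by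
`first | exact? | simpa | simpa [QuasiPeriodicExistence] | (unfold QuasiPeriodicExistence; simpa) | aesop`
(files `bc/probe_S*.lean` of the registrar, importing only the route file; the stub signature restated
verbatim as the hypothesis) — all six FAIL; raw results in the registrar's NOTES.md and the evidence note.

## References

* M. H. Freedman, *The topology of four-dimensional manifolds*, J. Differential Geom. 17 (1982), Thm 1.6.
  [FreedmanJDG1982] M. H. Freedman, F. Quinn, *Topology of 4-manifolds* (1990), Cor. 7.1B. [FreedmanQuinnPMS1990]
* M. Brown, *A proof of the generalized Schoenflies theorem*, Bull. AMS 66 (1960). [Brown1960]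
* J. W. S. Cassels, *An introduction to Diophantine approximation* (1957), Ch. V (badly approximable
  linear forms from real cubic fields). [Cassels1957] W. M. Schmidt, *Diophantine approximation*, LNM 785
  (1980), Ch. II. [Schmidt1980]
* R. Fintushel, *Circle actions on simply connected 4-manifolds*, TAMS 230 (1977); P. S. Pao, Topology 16
  (1977/78). [Fintushel1978] [Pao1978] M. R. Herman, *Sur la conjugaison différentiable des
  difféomorphismes du cercle à des rotations*, Publ. IHÉS 49 (1979). [Herman1979]
-/

-- `Summit.<Summit>.<Problem>`: single-conjunct summit, the duplicate component is mandated (CONVENTIONS §2).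
set_option linter.dupNamespace false
set_option linter.unusedVariables false

noncomputable section

namespace Summit.SmoothPoincare4.SmoothPoincare4.Cruxes.QuasiPeriodicExistence.Birth

open scoped Manifold ContDiff Topology ContinuousMap
open Set Function
open Summit.SmoothPoincare4.SmoothPoincare4.Theses.DiophantineRotations

/-! ## The three registered stubs (`sorry` lives ONLY here)

Vocabulary (all inline, Mathlib only): `S⁴ := Metric.sphere (0 : EuclideanSpace ℝ (Fin 5)) 1` with its
Mathlib `C^∞` structure (model `𝓡 4`), a point `y : S⁴` read in `ℝ⁵` through the coercion
`(y : EuclideanSpace ℝ (Fin 5))` and its coordinates `y 0, …, y 4` (`z₁ = (y 0, y 1)`, `z₂ = (y 2, y 3)`,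
`t = y 4`), exactly as in the crux; the model neighbourhood of the singular strata is the predicate
`y 0 ^ 2 + y 1 ^ 2 < 1/4 ∨ y 2 ^ 2 + y 3 ^ 2 < 1/4`; the cubic frequency is `(θ, θ ^ 2)` with `θ ^ 3 = 2`. -/

/-- **Stub S1 `stub_cubicFrequencyDiophantine` — the cubic pair `(θ, θ²)`, `θ³ = 2`, is simultaneously
Diophantine with exponent 2** (badly approximable pair of the real cubic field `ℚ(2^{1/3})`): there is
`γ > 0` with `γ ≤ |k₁θ + k₂θ² + m| · (|k₁| + |k₂|)²` for all integers `(k₁, k₂) ≠ (0, 0)`, `m`. Why true: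
`x = m + k₁θ + k₂θ²` is a nonzero element of `ℤ[θ]` (irreducibility of `X³ − 2`, i.e. 2-adic descent on
the norm form `m³ + 2k₁³ + 4k₂³ − 6mk₁k₂`), so `1 ≤ |N(x)| = |x|·|x'·x''|` and `|x'·x''| ≤ 25(|k₁|+|k₂|)²`
when `|x| < 1` (the case `|x| ≥ 1` is trivial with `γ ≤ 1`). Known; M-sized in Lean (no Mathlib support
for simultaneous approximation). [cite: Cassels1957, Ch. V §3] [cite: Schmidt1980, Ch. II] -/
theorem stub_cubicFrequencyDiophantine :
    ∀ θ : ℝ, θ ^ 3 = 2 → ∃ γ : ℝ, 0 < γ ∧ ∀ k₁ k₂ m : ℤ, (k₁ ≠ 0 ∨ k₂ ≠ 0) →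
      γ ≤ |(k₁ : ℝ) * θ + (k₂ : ℝ) * θ ^ 2 + (m : ℝ)| * (|(k₁ : ℝ)| + |(k₂ : ℝ)|) ^ (2 : ℝ) := by
  sorry

/-- **Stub S2 `stub_invariantConjugacy` — Freedman's homeomorphism can be taken smooth, with smooth
inverse, over the `R`-invariant model neighbourhood `N = {|z₁| < 1/2 ∨ |z₂| < 1/2}` of the singular
strata** (poles and the two invariant 2-spheres): every smooth homotopy 4-sphere `M` admits
`h : M ≃ₜ S⁴` with `h` of class `C^∞` on `h⁻¹(N)` and `h⁻¹` of class `C^∞` on `N`. Why true: `S⁴ ∖ N`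
contains a smooth closed round ball `B'` (around `(3/5, 0, 4/5, 0, 0)`); split `M = D ∪ C` along a smooth
3-sphere (`D` a smooth closed 4-ball, `C` compact contractible, `∂C ≅ S³`), send `D` diffeomorphically onto
the smooth 4-ball `S⁴ ∖ int B'` and `C` homeomorphically onto `B'` extending the boundary diffeomorphism
(Freedman: `C ∪ D⁴ ≈ S⁴`; Brown's Schoenflies theorem: `C ≈ D⁴`; Alexander trick for the boundary
matching). Known modulo the tree's named Freedman fact `nonempty_homeomorph_sphere_four` in this relative
form; L-sized in Lean. [cite: FreedmanJDG1982, Thm 1.6] [cite: Brown1960] [cite: FreedmanQuinnPMS1990, Cor. 7.1B] -/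
theorem stub_invariantConjugacy :
    ∀ (M : Type) [TopologicalSpace M] [T2Space M] [SecondCountableTopology M]
      [ChartedSpace (EuclideanSpace ℝ (Fin 4)) M] [IsManifold (𝓡 4) (⊤ : ℕ∞) M],
      Nonempty (M ≃ₕ Metric.sphere (0 : EuclideanSpace ℝ (Fin 5)) 1) →
      ∃ h : M ≃ₜ Metric.sphere (0 : EuclideanSpace ℝ (Fin 5)) 1,
        ContMDiffOn (𝓡 4) (𝓡 4) (⊤ : ℕ∞) (⇑h)
          {x : M | (h x : EuclideanSpace ℝ (Fin 5)) 0 ^ 2 + (h x : EuclideanSpace ℝ (Fin 5)) 1 ^ 2 < 1 / 4 ∨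
            (h x : EuclideanSpace ℝ (Fin 5)) 2 ^ 2 + (h x : EuclideanSpace ℝ (Fin 5)) 3 ^ 2 < 1 / 4} ∧
        ContMDiffOn (𝓡 4) (𝓡 4) (⊤ : ℕ∞) (⇑h.symm)
          {y : Metric.sphere (0 : EuclideanSpace ℝ (Fin 5)) 1 |
            (y : EuclideanSpace ℝ (Fin 5)) 0 ^ 2 + (y : EuclideanSpace ℝ (Fin 5)) 1 ^ 2 < 1 / 4 ∨
            (y : EuclideanSpace ℝ (Fin 5)) 2 ^ 2 + (y : EuclideanSpace ℝ (Fin 5)) 3 ^ 2 < 1 / 4} := by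
  sorry

/-- **Stub S3 `stub_smoothGeneratorCubic` — SMOOTH GENERATOR ON THE FAKE FREE BAND (the load-bearing
stub).** For `θ³ = 2` and a smooth 4-manifold `M` (summit binders) with a homeomorphism `h : M ≃ₜ S⁴`
that is `C^∞` with `C^∞` inverse over the invariant model neighbourhood `N` of the singular strata (the
output of S2), there are a diffeomorphism `F : M ≃ₘ M` and a homeomorphism `h' : M ≃ₜ S⁴` with
`h' ∘ F = R_{θ,θ²} ∘ h'` pointwise (coordinates of `S⁴ ⊂ ℝ⁵` written out as in the crux). Since `N` is
`R`-invariant, `h⁻¹ ∘ R ∘ h` is already a local diffeomorphism on `h⁻¹(N)`: the statement is the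
quasi-periodic Kirby problem on the fake free band `h⁻¹(S⁴ ∖ N) ≅_{top, rel ∂} T² × D²` at the cubic
frequency. Implied by `SmoothPoincare4`; open for exotic `M` (= K2 at one frequency). Why it might fail: the
smooth generator must preserve the wild transported orbit tori through the fake band; no construction
beyond `S⁴` is known; `DiophantineRigidity` on an exotic `M` would refute it. Size: open problem.
[cite: FreedmanJDG1982, Thm 1.6] [cite: Fintushel1978] [cite: Pao1978] [cite: Herman1979] -/
theorem stub_smoothGeneratorCubic :
    ∀ θ : ℝ, θ ^ 3 = 2 →
    ∀ (M : Type) [TopologicalSpace M] [T2Space M] [SecondCountableTopology M]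
      [ChartedSpace (EuclideanSpace ℝ (Fin 4)) M] [IsManifold (𝓡 4) (⊤ : ℕ∞) M]
      (h : M ≃ₜ Metric.sphere (0 : EuclideanSpace ℝ (Fin 5)) 1),
      ContMDiffOn (𝓡 4) (𝓡 4) (⊤ : ℕ∞) (⇑h)
        {x : M | (h x : EuclideanSpace ℝ (Fin 5)) 0 ^ 2 + (h x : EuclideanSpace ℝ (Fin 5)) 1 ^ 2 < 1 / 4 ∨
          (h x : EuclideanSpace ℝ (Fin 5)) 2 ^ 2 + (h x : EuclideanSpace ℝ (Fin 5)) 3 ^ 2 < 1 / 4} →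
      ContMDiffOn (𝓡 4) (𝓡 4) (⊤ : ℕ∞) (⇑h.symm)
        {y : Metric.sphere (0 : EuclideanSpace ℝ (Fin 5)) 1 |
          (y : EuclideanSpace ℝ (Fin 5)) 0 ^ 2 + (y : EuclideanSpace ℝ (Fin 5)) 1 ^ 2 < 1 / 4 ∨
          (y : EuclideanSpace ℝ (Fin 5)) 2 ^ 2 + (y : EuclideanSpace ℝ (Fin 5)) 3 ^ 2 < 1 / 4} →
      ∃ (F : Diffeomorph (𝓡 4) (𝓡 4) M M (⊤ : ℕ∞))
        (h' : M ≃ₜ Metric.sphere (0 : EuclideanSpace ℝ (Fin 5)) 1),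
        ∀ x : M, ((h' (F x) : Metric.sphere (0 : EuclideanSpace ℝ (Fin 5)) 1) : EuclideanSpace ℝ (Fin 5)) =
          WithLp.toLp 2
            ![Real.cos (2 * Real.pi * θ) * (h' x : EuclideanSpace ℝ (Fin 5)) 0 -
                Real.sin (2 * Real.pi * θ) * (h' x : EuclideanSpace ℝ (Fin 5)) 1,
              Real.sin (2 * Real.pi * θ) * (h' x : EuclideanSpace ℝ (Fin 5)) 0 +
                Real.cos (2 * Real.pi * θ) * (h' x : EuclideanSpace ℝ (Fin 5)) 1,
              Real.cos (2 * Real.pi * θ ^ 2) * (h' x : EuclideanSpace ℝ (Fin 5)) 2 -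
                Real.sin (2 * Real.pi * θ ^ 2) * (h' x : EuclideanSpace ℝ (Fin 5)) 3,
              Real.sin (2 * Real.pi * θ ^ 2) * (h' x : EuclideanSpace ℝ (Fin 5)) 2 +
                Real.cos (2 * Real.pi * θ ^ 2) * (h' x : EuclideanSpace ℝ (Fin 5)) 3,
              (h' x : EuclideanSpace ℝ (Fin 5)) 4] := by
  sorry

/-! ## The composition: the three stubs prove the crux BY NAME (no `sorry` below this line) -/

/-- **Composition with explicit hypotheses** (the BC3 shape `S1-sig → S2-sig → S3-sig → crux`). Proof:
the real cube root `θ = 2 ^ (3⁻¹)` has `θ ^ 3 = 2` (`Real.rpow_inv_natCast_pow`); given a smooth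
homotopy 4-sphere `M`, S2 gives `h : M ≃ₜ S⁴` standard over `N`, S3 gives `(F, h')` with
`h' ∘ F = R_{θ,θ²} ∘ h'`, S1 gives `γ > 0` certifying that `(θ, θ²)` is simultaneously Diophantine with
`τ = 2`; the crux's witness is `⟨F, h', θ, θ², ⟨γ, 2, _, _⟩, _⟩`. Pure logic. [folklore] -/
theorem quasiPeriodicExistence_of_stubs
    (hS1 : ∀ θ : ℝ, θ ^ 3 = 2 → ∃ γ : ℝ, 0 < γ ∧ ∀ k₁ k₂ m : ℤ, (k₁ ≠ 0 ∨ k₂ ≠ 0) →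
      γ ≤ |(k₁ : ℝ) * θ + (k₂ : ℝ) * θ ^ 2 + (m : ℝ)| * (|(k₁ : ℝ)| + |(k₂ : ℝ)|) ^ (2 : ℝ))
    (hS2 : ∀ (M : Type) [TopologicalSpace M] [T2Space M] [SecondCountableTopology M]
      [ChartedSpace (EuclideanSpace ℝ (Fin 4)) M] [IsManifold (𝓡 4) (⊤ : ℕ∞) M],
      Nonempty (M ≃ₕ Metric.sphere (0 : EuclideanSpace ℝ (Fin 5)) 1) →
      ∃ h : M ≃ₜ Metric.sphere (0 : EuclideanSpace ℝ (Fin 5)) 1,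
        ContMDiffOn (𝓡 4) (𝓡 4) (⊤ : ℕ∞) (⇑h)
          {x : M | (h x : EuclideanSpace ℝ (Fin 5)) 0 ^ 2 + (h x : EuclideanSpace ℝ (Fin 5)) 1 ^ 2 < 1 / 4 ∨
            (h x : EuclideanSpace ℝ (Fin 5)) 2 ^ 2 + (h x : EuclideanSpace ℝ (Fin 5)) 3 ^ 2 < 1 / 4} ∧
        ContMDiffOn (𝓡 4) (𝓡 4) (⊤ : ℕ∞) (⇑h.symm)
          {y : Metric.sphere (0 : EuclideanSpace ℝ (Fin 5)) 1 |
            (y : EuclideanSpace ℝ (Fin 5)) 0 ^ 2 + (y : EuclideanSpace ℝ (Fin 5)) 1 ^ 2 < 1 / 4 ∨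
            (y : EuclideanSpace ℝ (Fin 5)) 2 ^ 2 + (y : EuclideanSpace ℝ (Fin 5)) 3 ^ 2 < 1 / 4})
    (hS3 : ∀ θ : ℝ, θ ^ 3 = 2 →
      ∀ (M : Type) [TopologicalSpace M] [T2Space M] [SecondCountableTopology M]
        [ChartedSpace (EuclideanSpace ℝ (Fin 4)) M] [IsManifold (𝓡 4) (⊤ : ℕ∞) M]
        (h : M ≃ₜ Metric.sphere (0 : EuclideanSpace ℝ (Fin 5)) 1),
        ContMDiffOn (𝓡 4) (𝓡 4) (⊤ : ℕ∞) (⇑h)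
          {x : M | (h x : EuclideanSpace ℝ (Fin 5)) 0 ^ 2 + (h x : EuclideanSpace ℝ (Fin 5)) 1 ^ 2 < 1 / 4 ∨
            (h x : EuclideanSpace ℝ (Fin 5)) 2 ^ 2 + (h x : EuclideanSpace ℝ (Fin 5)) 3 ^ 2 < 1 / 4} →
        ContMDiffOn (𝓡 4) (𝓡 4) (⊤ : ℕ∞) (⇑h.symm)
          {y : Metric.sphere (0 : EuclideanSpace ℝ (Fin 5)) 1 |
            (y : EuclideanSpace ℝ (Fin 5)) 0 ^ 2 + (y : EuclideanSpace ℝ (Fin 5)) 1 ^ 2 < 1 / 4 ∨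
            (y : EuclideanSpace ℝ (Fin 5)) 2 ^ 2 + (y : EuclideanSpace ℝ (Fin 5)) 3 ^ 2 < 1 / 4} →
        ∃ (F : Diffeomorph (𝓡 4) (𝓡 4) M M (⊤ : ℕ∞))
          (h' : M ≃ₜ Metric.sphere (0 : EuclideanSpace ℝ (Fin 5)) 1),
          ∀ x : M, ((h' (F x) : Metric.sphere (0 : EuclideanSpace ℝ (Fin 5)) 1) : EuclideanSpace ℝ (Fin 5)) =
            WithLp.toLp 2
              ![Real.cos (2 * Real.pi * θ) * (h' x : EuclideanSpace ℝ (Fin 5)) 0 -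
                  Real.sin (2 * Real.pi * θ) * (h' x : EuclideanSpace ℝ (Fin 5)) 1,
                Real.sin (2 * Real.pi * θ) * (h' x : EuclideanSpace ℝ (Fin 5)) 0 +
                  Real.cos (2 * Real.pi * θ) * (h' x : EuclideanSpace ℝ (Fin 5)) 1,
                Real.cos (2 * Real.pi * θ ^ 2) * (h' x : EuclideanSpace ℝ (Fin 5)) 2 -
                  Real.sin (2 * Real.pi * θ ^ 2) * (h' x : EuclideanSpace ℝ (Fin 5)) 3,
                Real.sin (2 * Real.pi * θ ^ 2) * (h' x : EuclideanSpace ℝ (Fin 5)) 2 +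
                  Real.cos (2 * Real.pi * θ ^ 2) * (h' x : EuclideanSpace ℝ (Fin 5)) 3,
                (h' x : EuclideanSpace ℝ (Fin 5)) 4]) :
    QuasiPeriodicExistence := by
  intro M _ _ _ _ _ hM
  -- the real cube root of 2
  obtain ⟨θ, hθ⟩ : ∃ θ : ℝ, θ ^ 3 = 2 :=
    ⟨(2 : ℝ) ^ ((3 : ℕ) : ℝ)⁻¹, Real.rpow_inv_natCast_pow (by norm_num) (by norm_num)⟩
  -- S1: `(θ, θ²)` is simultaneously Diophantine with exponent 2
  obtain ⟨γ, hγ, hD⟩ := hS1 θ hθ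
  -- S2: Freedman's homeomorphism, standard over the invariant neighbourhood of the singular strata
  obtain ⟨h, hh, hh'⟩ := hS2 M hM
  -- S3: the smooth generator on the fake free band at the cubic frequency
  obtain ⟨F, h', hc⟩ := hS3 θ hθ M h hh hh'
  exact ⟨F, h', θ, θ ^ 2, ⟨γ, 2, hγ, hD⟩, hc⟩

/-- **THE SKELETON THEOREM.** The crux
`Summit.SmoothPoincare4.SmoothPoincare4.Theses.DiophantineRotations.QuasiPeriodicExistence`, concluded BY
NAME from the three DECLARED stubs `stub_cubicFrequencyDiophantine`, `stub_invariantConjugacy`,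
`stub_smoothGeneratorCubic` (the only `sorry`s of the file) through the sorry-free composition
`quasiPeriodicExistence_of_stubs`. [folklore] -/
theorem QuasiPeriodicExistence_of : QuasiPeriodicExistence :=
  quasiPeriodicExistence_of_stubs stub_cubicFrequencyDiophantine stub_invariantConjugacy
    stub_smoothGeneratorCubic

end Summit.SmoothPoincare4.SmoothPoincare4.Cruxes.QuasiPeriodicExistence.Birth

end
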